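import Summits.Langlands.Langlands.Statement
import HarnessLib

/-!
# Stub `stub_llc_eps_artin_eq` for line `Sketch_18745_r1_k1` (crux stmt-Langlands-18745)

The pins identify the `ε`-Artin DATA: for two reciprocity data `𝓡 𝓡' : ReciprocityData K` and a
finite place `v`, the dependent functions `(𝓡.llc v).eps.artin` and `(𝓡'.llc v).eps.artin`
(assigning to every finite extension `E / K_v` a `LocalArtinData E`) are equal.  The tree's
`ReciprocityData.eps_artin_eq` (from the pin `llc_eps_isCanonical`) gives equality of the
underlying homomorphisms `W_E →* Eˣ` at every `E`; the remaining fields of `LocalArtinData` are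
propositions, so the structures agree (`localArtinData_eq_of_artin_eq`), and `funext` over `E` and
its six instance binders closes the stub.
-/

set_option linter.dupNamespace false -- `Summit.Langlands.Langlands` is the mandated namespace

noncomputable section

open scoped NumberField
open NumberField IsDedekindDomain Literature.NumberTheory.Automorphic
open Literature.NumberTheory.GaloisRepresentations Summit.Langlands

namespace Summit.Langlands.Langlands.Theorems.ReciprocityRigidity

/-- Two local Artin data with the same Artin homomorphism `W_E →* Eˣ` are equal: the other four
fields of `LocalArtinData` (`isOpenQuotientMap_artin`, `ker_artin`, `image_inertia`, `artin_frob`)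
are propositions. [folklore] -/
theorem localArtinData_eq_of_artin_eq {E : Type} [Field E] [ValuativeRel E] [TopologicalSpace E]
    [IsNonarchimedeanLocalField E] {d d' : LocalArtinData E} (h : d.artin = d'.artin) : d = d' := by
  cases d
  cases d'
  cases h
  rfl

variable {K : Type} [Field K] [NumberField K]

/-- **Stub S2 (the pins identify the local Artin data of the `ε`-systems at every finite
extension, as a dependent function).**  From `ReciprocityData.eps_artin_eq` (equality of the
homomorphisms, by the pin `llc_eps_isCanonical`) and the fact that the other fields of
`LocalArtinData` are propositions (`localArtinData_eq_of_artin_eq`). [folklore] -/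
theorem stub_llc_eps_artin_eq (𝓡 𝓡' : ReciprocityData K) (v : HeightOneSpectrum (𝓞 K)) :
    (𝓡.llc v).eps.artin = (𝓡'.llc v).eps.artin := by
  funext E _ _ _ _ _ _
  exact localArtinData_eq_of_artin_eq (𝓡.eps_artin_eq 𝓡' v E)

end Summit.Langlands.Langlands.Theorems.ReciprocityRigidity
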